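import Mathlib
import Summits.Ventures.PercRepro2.HCov
import Summits.Ventures.PercRepro2.Graph
import Summits.Ventures.PercRepro2.RECMReduction
import Summits.Ventures.PercRepro2.CutVertexPaths
import Summits.Ventures.PercRepro2.IsolatedMark
import Summits.Ventures.PercRepro2.GcSkelRules
import Summits.Ventures.PercRepro2.GcSkelReduction
import Summits.Ventures.PercRepro2.GcSkelReductionI
import Summits.Ventures.PercRepro2.GcSkelCutShape
import Summits.Ventures.PercRepro2.GcSkelCutShapeMain

/-!
# The residual is connected on its marks (blind cell PercRepro2, typer-1 g53)

A consequence of the one open shape (`cutVertex_shape_of_wredI`, GcSkelCutShapeMain.lean): on the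
weighted residual `WRed.WReducedI` the five marks lie in ONE component of the graph (every edge
open). Proof: if a mark `m` were outside the component `K` of `a₁`, then `a₁` would be a cut
vertex between `K ∖ {a₁}` and `Kᶜ` (`cutVertex_cluster`: an edge with one end in `K` has both ends
in `K`), with a non-loop edge on each side (`a₁` and `m` are not isolated; for `m = a₃` class `R₃`
is excluded) — and the one open shape puts an UNMARKED vertex at the cut, against `v = a₁`.

* **`cutVertex_cluster`**: the cut at a vertex `w` between its component and the rest;
* **`marks_conn_of_wredI`**: on `WReducedI`, `a₂, a₃, o, b` are all connected to `a₁` when every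
  edge is open;
* **`a3_active_of_wredI`**: in particular `a₃` is active (some configuration joins it to a root) —
  the hypothesis of `A3Inactive.HCov_of_a3Inactive` never holds on the residual.
-/

namespace Summit.Ventures.PercRepro2

open CovForm RECM CutVertexM9

namespace WRed

section Cut

variable {V : Type*} {E : Type*}

/-- The all-open configuration. -/
def allOpenConfig (E : Type*) : Config E := fun _ => true

/-- In the all-open configuration, an edge with one end in the component of `w` has both ends in
it. -/
lemma mem_cluster_of_mem_edge {ends : E → Sym2 V} {w x y : V} {e : E}
    (hx : x ∈ cluster ends (allOpenConfig E) w) (hxe : x ∈ ends e) (hye : y ∈ ends e) :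
    y ∈ cluster ends (allOpenConfig E) w := by
  by_cases hxy : x = y
  · exact hxy ▸ hx
  · refine mem_cluster_of_adj hx (openGraph_adj.2 ⟨hxy, e, rfl, ?_⟩)
    exact (Sym2.mem_and_mem_iff hxy).1 ⟨hxe, hye⟩

/-- **The cut at a vertex between its component and the rest**: with `K` the component of `w` (every
edge open) and `side` marking the edges with both ends in `K`, `w` is a cut vertex between
`K ∖ {w}` and `Kᶜ`. -/
lemma cutVertex_cluster (ends : E → Sym2 V) (w : V) (side : E → Bool)
    (hside : ∀ e, side e = true ↔ ∀ x ∈ ends e, x ∈ cluster ends (allOpenConfig E) w) :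
    CutVertex ends side (cluster ends (allOpenConfig E) w \ {w}) w
      (cluster ends (allOpenConfig E) w)ᶜ where
  left := by
    intro e he x hx
    have hall := (hside e).1 he
    by_cases hxw : x = w
    · exact Or.inr hxw
    · exact Or.inl ⟨hall x hx, hxw⟩
  right := by
    intro e he x hx
    have hnot : ¬ ∀ x ∈ ends e, x ∈ cluster ends (allOpenConfig E) w := fun hall =>
      by simp [(hside e).2 hall] at he
    left
    intro hxK
    exact hnot fun _ hy => mem_cluster_of_mem_edge hxK hx hy
  disj := fun x hx hx' => hx' hx.1
  vL := fun h => h.2 rfl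
  vR := fun h => h (mem_cluster_self ends (allOpenConfig E) w)

/-- A non-loop edge at a vertex of the component of `w` is a left edge of `cutVertex_cluster`. -/
lemma side_true_of_mem_cluster {ends : E → Sym2 V} {w x : V} {e : E} {side : E → Bool}
    (hside : ∀ e, side e = true ↔ ∀ x ∈ ends e, x ∈ cluster ends (allOpenConfig E) w)
    (hx : x ∈ cluster ends (allOpenConfig E) w) (hxe : x ∈ ends e) : side e = true :=
  (hside e).2 fun _ hy => mem_cluster_of_mem_edge hx hxe hy

/-- A non-loop edge at a vertex outside the component of `w` is a right edge of
`cutVertex_cluster`. -/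
lemma side_false_of_not_mem_cluster {ends : E → Sym2 V} {w x : V} {e : E} {side : E → Bool}
    (hside : ∀ e, side e = true ↔ ∀ x ∈ ends e, x ∈ cluster ends (allOpenConfig E) w)
    (hx : x ∉ cluster ends (allOpenConfig E) w) (hxe : x ∈ ends e) : side e = false := by
  cases hs : side e with
  | true => exact absurd ((hside e).1 hs x hxe) hx
  | false => rfl

/-- A vertex that is not isolated lies on a non-loop edge. -/
lemma exists_edge_of_not_isolated {ends : E → Sym2 V} {x : V}
    (hx : ¬ IsolatedMark.IsIsolated ends x) : ∃ e, x ∈ ends e ∧ ¬ (ends e).IsDiag := by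
  unfold IsolatedMark.IsIsolated at hx
  push Not at hx
  exact hx

end Cut

section Main

variable {V : Type*} {E : Type*} [Fintype E] [DecidableEq V]
variable {ends : E → Sym2 V} {o a₁ a₂ a₃ b : V}

/-- **A mark outside the component of `a₁` contradicts the one open shape**: `a₁` would be a cut
vertex with a non-loop edge on each side, and the shape puts an unmarked vertex at the cut. -/
lemma mem_cluster_a1_of_wredI (h : WReducedI ends o a₁ a₂ a₃ b)
    (h12 : a₁ ≠ a₂) (h13 : a₁ ≠ a₃) (h23 : a₂ ≠ a₃) (ho1 : o ≠ a₁) (ho2 : o ≠ a₂) (ho3 : o ≠ a₃)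
    (hob : o ≠ b) (hb1 : b ≠ a₁) (hb2 : b ≠ a₂) (hb3 : b ≠ a₃) {m : V}
    (hm : ∃ e, m ∈ ends e ∧ ¬ (ends e).IsDiag) : m ∈ cluster ends (allOpenConfig E) a₁ := by
  classical
  by_contra hmK
  let side : E → Bool := fun e => decide (∀ x ∈ ends e, x ∈ cluster ends (allOpenConfig E) a₁)
  have hside : ∀ e, side e = true ↔ ∀ x ∈ ends e, x ∈ cluster ends (allOpenConfig E) a₁ :=
    fun e => decide_eq_true_iff
  have hcut := cutVertex_cluster ends a₁ side hside
  -- a non-loop edge on the left: at `a₁`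
  obtain ⟨e₁, h1e, h1d⟩ := exists_edge_of_not_isolated h.notIso_a1
  have hL : ∃ g, side g = true ∧ ¬ (ends g).IsDiag :=
    ⟨e₁, side_true_of_mem_cluster hside (mem_cluster_self ends (allOpenConfig E) a₁) h1e, h1d⟩
  -- a non-loop edge on the right: at `m`
  obtain ⟨em, hme, hmd⟩ := hm
  have hR : ∃ g, side g = false ∧ ¬ (ends g).IsDiag :=
    ⟨em, side_false_of_not_mem_cluster hside hmK hme, hmd⟩
  rcases cutVertex_shape_of_wredI h hcut hL hR h12 h13 h23 ho1 ho2 ho3 hob hb1 hb2 hb3 with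
    hs | hs
  · exact hs.unmarked_v.2.1 rfl
  · exact hs.unmarked_v.2.1 rfl

/-- **THE RESIDUAL IS CONNECTED ON ITS MARKS**: on `WReducedI`, with every edge open, `a₂, a₃, o, b`
are all connected to `a₁`. -/
theorem marks_conn_of_wredI (h : WReducedI ends o a₁ a₂ a₃ b)
    (h12 : a₁ ≠ a₂) (h13 : a₁ ≠ a₃) (h23 : a₂ ≠ a₃) (ho1 : o ≠ a₁) (ho2 : o ≠ a₂) (ho3 : o ≠ a₃)
    (hob : o ≠ b) (hb1 : b ≠ a₁) (hb2 : b ≠ a₂) (hb3 : b ≠ a₃) :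
    Conn ends (allOpenConfig E) a₁ a₂ ∧ Conn ends (allOpenConfig E) a₁ a₃ ∧
      Conn ends (allOpenConfig E) a₁ o ∧ Conn ends (allOpenConfig E) a₁ b := by
  refine ⟨?_, ?_, ?_, ?_⟩
  · exact mem_cluster_a1_of_wredI h h12 h13 h23 ho1 ho2 ho3 hob hb1 hb2 hb3
      (exists_edge_of_not_isolated h.notIso_a2)
  · obtain ⟨e, z, he, hz⟩ := exists_a3_edge_of_not_a3ToMarks h.notR3
    refine mem_cluster_a1_of_wredI h h12 h13 h23 ho1 ho2 ho3 hob hb1 hb2 hb3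
      ⟨e, by rw [he]; exact Sym2.mem_mk_left _ _, ?_⟩
    rw [he, Sym2.mk_isDiag_iff]
    exact fun h' => hz.2.2.2.1 h'.symm
  · exact mem_cluster_a1_of_wredI h h12 h13 h23 ho1 ho2 ho3 hob hb1 hb2 hb3
      (exists_edge_of_not_isolated h.notIso_o)
  · exact mem_cluster_a1_of_wredI h h12 h13 h23 ho1 ho2 ho3 hob hb1 hb2 hb3
      (exists_edge_of_not_isolated h.notIso_b)

/-- **`a₃` is active on the residual**: some configuration joins it to a root — the hypothesis of
`A3Inactive.HCov_of_a3Inactive` (no configuration does) never holds on `WReducedI`. -/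
theorem a3_active_of_wredI (h : WReducedI ends o a₁ a₂ a₃ b)
    (h12 : a₁ ≠ a₂) (h13 : a₁ ≠ a₃) (h23 : a₂ ≠ a₃) (ho1 : o ≠ a₁) (ho2 : o ≠ a₂) (ho3 : o ≠ a₃)
    (hob : o ≠ b) (hb1 : b ≠ a₁) (hb2 : b ≠ a₂) (hb3 : b ≠ a₃) :
    ¬ ∀ ω : Config E, ¬ Conn ends ω a₁ a₃ ∧ ¬ Conn ends ω a₂ a₃ := fun hin =>
  (hin (allOpenConfig E)).1
    (marks_conn_of_wredI h h12 h13 h23 ho1 ho2 ho3 hob hb1 hb2 hb3).2.1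

end Main

end WRed

end Summit.Ventures.PercRepro2
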